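import Literature.MathematicalPhysics.QuantumFieldTheory.Balaban1983to89.AveragingImageLawGaugeInvariance
import Summits.QuantumFields.YangMills.Theorems.BalabanUVNodesN08HaarCompatibilityOneBond

/-!
# BalabanUVNodes ∕ N08 — E6′ AT THE RECORD'S AVERAGING HOLDS ON EVERY PRIVATE-SOURCE ∕ PRIVATE-TARGET BOND FAMILY, every level, every `N`: under ANY
# coarse-gauge-invariant law (so under the image law `Ū_*(dU)` of every covariant averaging, [Balaban1987RG1] p. 265) a family of bond variables with private
# sources (or private targets) is EXACTLY product-Haar distributed; at `Ū := avOfPrint N S j` and for EVERY version `𝔗` of (10), `∫ T1 · φ(V ∘ b) dV = ∫ φ(V ∘ b) dV`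
# — the acyclic part of the E6′ identity at N08's slot is a THEOREM; only cycle holonomies remain (E6′ proper, NOT IN PRINT, undecided at `N ≥ 2`)

WIDTH SEAT `pub-ymgap-dag-n08-w3` g0, plan `W-SEAT-START-LIST.md` §n08 item 3 PART 3, 2026-08-27.  Track A, DAG node N08 = [Balaban1985UV3] Thm 1 p. 257 (compact) + Thm 2
p. 272; key item K1⁷ `StabilityBAtRecordR13SepCoPH` (stmt-QuantumFields-20542), `--supports … --as helper`.  COUNT-NEUTRAL.  Part 1 = `…N08HaarCompatibilityInhabited`
(p583667: the letters inhabited; E6′ beyond the range), part 2 = `…N08HaarCompatibilityOneBond` (p585871: one-bond σ-algebras, in range).  Cell ym3-torus's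
`AveragingImageLawGaugeInvariance` (seat p2 g12) records in its header — «recorded, not formalised» — that E6′ can fail only through the JOINT law of CYCLE holonomies;
§0–§3 below formalise the acyclic half in the simplest robust shape, GENERIC in the averaging (so other lanes may read it by name), §4–§5 read it at the [B10] slot's
objects: print's averaging of record `B10RunsOfRecord.avOfPrint N S j` on `Node00.SU N` and the version families `Node00.TFamily₃ N L` of (10) along it.

A PRIVATE-SOURCE family of bonds of `T^{(k)}` is `b : ι → PBond P k` with pairwise distinct sources none of which is a member's target (`hsrc`, `hpriv`); PRIVATE-TARGET is
the mirror (`htgt`, `hpriv`) — single bonds, the `d` bonds entering (resp. issuing from) one site, families with pairwise disjoint endpoint sets, …  NOT every forest: a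
shared source, or a source that is another member's target (an oriented path), is excluded; the general forest statement needs a leaf induction and is not attempted.

WHAT PRINT SAYS.  [Balaban1987RG1] p. 265 (after (2.1)): «The gauge covariance of the averages implies that the δ-functions in (2.1) are invariant under the gauge
transformations V → V^v» (tree: `AveragingImageLawGaugeInvariance.map_gaugeAct_imageLaw`); `dU` is gauge invariant ([Balaban1985Averaging] (10)∕(12) p. 19; tree:
`B12RTGaugeInvariance254.measurePreserving_gaugeAct`).  Nothing else of print is used.

WHAT THIS FILE PROVES (kernel bookkeeping + [folklore] measure theory on compact groups; nothing of Bałaban's asserted; E6′ proper neither proved nor refuted):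
* §0 `eq_of_isMulLeftInvariant` — on ANY compact second-countable group two left-invariant probability measures coincide (the sibling's lemma asks a `GaugeGroup`; this
  one a bare `Group`, so that it applies to the product group `ι → G`).
* §1 for EVERY probability measure `ν` on `GaugeField P k G` invariant under all gauge transformations (`G` compact second countable) and every private-source family:
  `exists_gaugeTransf_mul_left`, `measurable_evalFamily`, **`map_evalFamily_eq_pi_haar`** (`ν ∘ (V ↦ V ∘ b)⁻¹ = Haar^ι`: the gauge transformations at the private sources
  act on `G^ι` by ALL left translations; §0), `integral_comp_evalFamily`; §1b the private-TARGET mirror `exists_gaugeTransf_mul_right`, `map_inv_pi_haar`,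
  **`map_evalFamily_eq_pi_haar_of_tgt`** (invert every coordinate).
* §2 at `ν := dU` (any level): `map_gaugeAct_fieldMeasure`, `map_evalFamily_fieldMeasure_eq_pi_haar`, `integral_comp_evalFamily_fieldMeasure`.
* §3 at `ν := Ū_*(dU)` for EVERY covariant averaging `av : Averaging P j G` of the standing range with measurable `Ū`: **`map_evalFamily_imageLaw_eq_pi_haar`** ∕ `…_of_tgt`
  (`Law_{dU}((Ū(·)(b i))_i) = Haar^ι`), `integral_comp_avg_evalFamily`, `integral_comp_avg_evalFamily_eq` (`= ∫ φ(V ∘ b) dV`: image law and `dV` AGREE there, whatever E6′).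
* §4 at `Ū := avOfPrint N S j` on `SU(N)`, EVERY level (gauge invariance of the image law at every level = part 2's `map_gaugeAct_imageLaw_avOfPrint`), every `N`:
  `map_evalFamily_avOfPrint_eq_pi_haar[_of_tgt]`, `integral_comp_avOfPrint_evalFamily[_of_tgt]`.
* §5 THE LETTER for EVERY version family `𝔗 : Node00.TFamily₃ N L`, every member, level, private-source (resp. -target) family, bounded measurable `φ : (ι → SU N) → ℝ`:
  `integral_T_one_mul_comp_evalFamily_eq_integral_avg` (the push-forward identity (10) at `φ ∘ (V ↦ V ∘ b)`), `integral_T_one_mul_comp_evalFamily[_of_tgt]`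
  (`∫ (𝔗 S j).T 1 (V) · φ(V ∘ b) dV = ∫ φ dHaar^ι`), **`integral_T_one_mul_comp_evalFamily_eq[_of_tgt]`** (`= ∫ φ(V ∘ b) dV`: the E6′ identity `(T1)·dV = dV` HOLDS on the
  σ-algebra of every private-source ∕ private-target family), `integral_T_one_sub_one_mul_comp_evalFamily` (the defect `T1 − 1` is orthogonal to all such observables).
WHAT IT DOES NOT PROVE (said): `T1 =ᵐ 1` ∕ `Ū_*(dU) = dV` on the full σ-algebra — the joint law of CYCLE holonomies (plaquettes; 2-cycles on the side-2 torus of part 1 §4) —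
NOT IN PRINT, undecided at `N ≥ 2` (pub-balaban3d DEPMAP v6 §16 N22; dag-n08-a SEAM note; chair R451); general forests (shared sources).

HONEST FRAMING.  Count-neutral helper; N08 NOT discharged; counts unmoved; one finite 𝕋⁴ programme at fixed ε; R4 closes the CONDITIONAL rung `BalabanLadder.UV`
only; the Yang–Mills mass gap (Clay) is NOT proved by any of this; nothing continuum ∕ ℝ³ ∕ ℝ⁴ ∕ OS ∕ mass gap.  0 `sorry`, 0 `def`, 0 `instance`, standard axioms.
-/

noncomputable section

open MeasureTheory

namespace Summit.QuantumFields.YangMills.BalabanUVNodes.N08HaarCompatibilityPrivateSources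

open Literature.MathematicalPhysics.QuantumFieldTheory.Balaban1983to89
open Literature.MathematicalPhysics.QuantumFieldTheory.Balaban1983to89.AveragingImageLawGaugeInvariance (map_gaugeAct_imageLaw isProbabilityMeasure_imageLaw)
open Literature.MathematicalPhysics.QuantumFieldTheory.Balaban1983to89.B12RTGaugeInvariance254 (measurable_gaugeAct measurePreserving_gaugeAct)


/-! ## §0 Uniqueness of the normalised Haar measure on a bare compact second-countable group -/

/-- Two left-invariant probability measures on a compact second-countable group coincide (both are `haarMeasure ⊤`). [cite: BrockerTomDieck1985, I (5.12)] -/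
theorem eq_of_isMulLeftInvariant {K : Type*} [Group K] [TopologicalSpace K] [IsTopologicalGroup K] [CompactSpace K]
    [SecondCountableTopology K] [MeasurableSpace K] [BorelSpace K] (μ ν : Measure K) [IsProbabilityMeasure μ] [IsProbabilityMeasure ν]
    [μ.IsMulLeftInvariant] [ν.IsMulLeftInvariant] : μ = ν := by
  have hne : Nonempty K := ⟨1⟩
  have hμ := Measure.haarMeasure_unique μ (⊤ : TopologicalSpace.PositiveCompacts K)
  have hν := Measure.haarMeasure_unique ν (⊤ : TopologicalSpace.PositiveCompacts K)
  rw [TopologicalSpace.PositiveCompacts.coe_top, measure_univ, one_smul] at hμ hν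
  rw [hμ, hν]

/-! ## §1 Private-source families under a gauge-invariant law -/

section Generic

variable {P : Params} {k : ℕ} {G : Type*} [GaugeGroup G] [MeasurableSpace G]
  [TopologicalSpace G] [IsTopologicalGroup G] [CompactSpace G] [SecondCountableTopology G] [BorelSpace G] [HaarData G] [MeasurableMul₂ G]
  {ι : Type*} [Fintype ι] {b : ι → PBond P k}

omit [MeasurableSpace G] [TopologicalSpace G] [IsTopologicalGroup G] [CompactSpace G] [SecondCountableTopology G] [BorelSpace G] [HaarData G]
  [MeasurableMul₂ G] [Fintype ι] in
/-- For a private-source family, the gauge transformation `g i` at the source of `b i` (and `1` elsewhere) multiplies `V(b i)` on the LEFT by `g i`, simultaneously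
for all `i`. [cite: Balaban1985Averaging, (8) p.19] -/
theorem exists_gaugeTransf_mul_left (hsrc : Function.Injective fun i => (b i).src) (hpriv : ∀ i i', (b i).src ≠ (b i').tgt) (g : ι → G) :
    ∃ v : GaugeTransf P k G, ∀ (V : GaugeField P k G) (i : ι), GaugeField.gaugeAct v V (b i) = g i * V (b i) := by
  classical
  refine ⟨fun y => if h : ∃ i, (b i).src = y then g h.choose else 1, fun V i => ?_⟩
  have hs : ∃ i', (b i').src = (b i).src := ⟨i, rfl⟩
  have hchoose : hs.choose = i := hsrc hs.choose_spec
  have ht : ¬ ∃ i', (b i').src = (b i).tgt := fun ⟨i', hi'⟩ => hpriv i' i hi'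
  show (if h : ∃ i', (b i').src = (b i).src then g h.choose else 1) * V (b i) *
      (if h : ∃ i', (b i').src = (b i).tgt then g h.choose else 1)⁻¹ = g i * V (b i)
  rw [dif_pos hs, dif_neg ht, hchoose, inv_one, mul_one]

omit [GaugeGroup G] [TopologicalSpace G] [IsTopologicalGroup G] [CompactSpace G] [SecondCountableTopology G] [BorelSpace G] [HaarData G] [MeasurableMul₂ G]
  [Fintype ι] in
/-- The family-evaluation map `V ↦ (V(b i))_i` is measurable. [folklore] -/
theorem measurable_evalFamily (b : ι → PBond P k) : Measurable fun (V : GaugeField P k G) (i : ι) => V (b i) :=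
  measurable_pi_lambda _ fun i => measurable_pi_apply (b i)

/-- **PRIVATE-SOURCE MARGINALS OF A GAUGE-INVARIANT LAW ARE PRODUCT HAAR**: for every probability measure `ν` on `GaugeField P k G` invariant under all gauge
transformations and every private-source family `b`, `ν ∘ (V ↦ V ∘ b)⁻¹ = Haar^ι`. [cite: Balaban1987RG1, (2.1) p.265 (the gauge-invariance sentence this reads)] -/
theorem map_evalFamily_eq_pi_haar (hsrc : Function.Injective fun i => (b i).src) (hpriv : ∀ i i', (b i).src ≠ (b i').tgt)
    (ν : Measure (GaugeField P k G)) [IsProbabilityMeasure ν] (hν : ∀ v : GaugeTransf P k G, ν.map (GaugeField.gaugeAct v) = ν) :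
    ν.map (fun (V : GaugeField P k G) (i : ι) => V (b i)) = Measure.pi fun _ : ι => (HaarData.haar : Measure G) := by
  have hΦ : Measurable fun (V : GaugeField P k G) (i : ι) => V (b i) := measurable_evalFamily b
  haveI : IsProbabilityMeasure (ν.map fun (V : GaugeField P k G) (i : ι) => V (b i)) := Measure.isProbabilityMeasure_map hΦ.aemeasurable
  haveI : (ν.map fun (V : GaugeField P k G) (i : ι) => V (b i)).IsMulLeftInvariant := by
    refine ⟨fun g => ?_⟩
    obtain ⟨v, hv⟩ := exists_gaugeTransf_mul_left hsrc hpriv g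
    have hcomp : ((fun W : ι → G => g * W) ∘ fun (V : GaugeField P k G) (i : ι) => V (b i)) =
        (fun (V : GaugeField P k G) (i : ι) => V (b i)) ∘ GaugeField.gaugeAct v := by
      funext V; funext i
      simp only [Function.comp, Pi.mul_apply, hv V i]
    rw [Measure.map_map (measurable_const_mul g) hΦ, hcomp, ← Measure.map_map hΦ (measurable_gaugeAct v), hν v]
  haveI : (HaarData.haar : Measure G).IsMulLeftInvariant := ⟨fun g => HaarData.map_mul_left g⟩
  exact eq_of_isMulLeftInvariant _ _

/-- `∫ φ(V ∘ b) dν = ∫ φ dHaar^ι` for a gauge-invariant probability law `ν` and a private-source family `b`. [cite: Balaban1987RG1, (2.1) p.265 (bookkeeping)] -/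
theorem integral_comp_evalFamily (hsrc : Function.Injective fun i => (b i).src) (hpriv : ∀ i i', (b i).src ≠ (b i').tgt)
    (ν : Measure (GaugeField P k G)) [IsProbabilityMeasure ν] (hν : ∀ v : GaugeTransf P k G, ν.map (GaugeField.gaugeAct v) = ν)
    (φ : (ι → G) → ℝ) (hφ : AEStronglyMeasurable φ (Measure.pi fun _ : ι => (HaarData.haar : Measure G))) :
    ∫ V, φ (fun i => V (b i)) ∂ν = ∫ W, φ W ∂(Measure.pi fun _ : ι => (HaarData.haar : Measure G)) := by
  rw [← map_evalFamily_eq_pi_haar hsrc hpriv ν hν] at hφ ⊢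
  exact (integral_map (measurable_evalFamily b).aemeasurable hφ).symm

/-! ### §1b The mirror case: private TARGETS (e.g. the `d` bonds issuing from one site) -/

omit [MeasurableSpace G] [TopologicalSpace G] [IsTopologicalGroup G] [CompactSpace G] [SecondCountableTopology G] [BorelSpace G] [HaarData G]
  [MeasurableMul₂ G] [Fintype ι] in
/-- For a private-TARGET family (targets pairwise distinct and the source of no member), the gauge transformation `g i` at the target of `b i` multiplies `V(b i)` on
the RIGHT by `(g i)⁻¹`, simultaneously for all `i`. [cite: Balaban1985Averaging, (8) p.19] -/
theorem exists_gaugeTransf_mul_right (htgt : Function.Injective fun i => (b i).tgt) (hpriv : ∀ i i', (b i).tgt ≠ (b i').src) (g : ι → G) :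
    ∃ v : GaugeTransf P k G, ∀ (V : GaugeField P k G) (i : ι), GaugeField.gaugeAct v V (b i) = V (b i) * (g i)⁻¹ := by
  classical
  refine ⟨fun y => if h : ∃ i, (b i).tgt = y then g h.choose else 1, fun V i => ?_⟩
  have ht : ∃ i', (b i').tgt = (b i).tgt := ⟨i, rfl⟩
  have hchoose : ht.choose = i := htgt ht.choose_spec
  have hs : ¬ ∃ i', (b i').tgt = (b i).src := fun ⟨i', hi'⟩ => hpriv i' i hi'
  show (if h : ∃ i', (b i').tgt = (b i).src then g h.choose else 1) * V (b i) *
      (if h : ∃ i', (b i').tgt = (b i).tgt then g h.choose else 1)⁻¹ = V (b i) * (g i)⁻¹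
  rw [dif_neg hs, dif_pos ht, hchoose, one_mul]

omit [MeasurableMul₂ G] in
/-- Coordinatewise inversion preserves the product Haar measure. [folklore] -/
theorem map_inv_pi_haar : (Measure.pi fun _ : ι => (HaarData.haar : Measure G)).map (fun (W : ι → G) (i : ι) => (W i)⁻¹) =
    Measure.pi fun _ : ι => (HaarData.haar : Measure G) :=
  (measurePreserving_pi (fun _ : ι => (HaarData.haar : Measure G)) (fun _ => HaarData.haar)
    (f := fun _ (h : G) => h⁻¹) fun _ => ⟨measurable_inv, HaarData.map_inv⟩).map_eq

/-- **PRIVATE-TARGET MARGINALS OF A GAUGE-INVARIANT LAW ARE PRODUCT HAAR** (mirror of `map_evalFamily_eq_pi_haar`: invert every coordinate, which turns the right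
translations into left ones and fixes `Haar^ι`). [cite: Balaban1987RG1, (2.1) p.265 (the gauge-invariance sentence this reads)] -/
theorem map_evalFamily_eq_pi_haar_of_tgt (htgt : Function.Injective fun i => (b i).tgt) (hpriv : ∀ i i', (b i).tgt ≠ (b i').src)
    (ν : Measure (GaugeField P k G)) [IsProbabilityMeasure ν] (hν : ∀ v : GaugeTransf P k G, ν.map (GaugeField.gaugeAct v) = ν) :
    ν.map (fun (V : GaugeField P k G) (i : ι) => V (b i)) = Measure.pi fun _ : ι => (HaarData.haar : Measure G) := by
  -- the inverted family map `Ψ V := (V(b i)⁻¹)_i` is pushed to a LEFT-invariant probability measure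
  have hΨ : Measurable fun (V : GaugeField P k G) (i : ι) => (V (b i))⁻¹ :=
    measurable_pi_lambda _ fun i => (measurable_pi_apply (b i)).inv
  have hinv : Measurable fun (W : ι → G) (i : ι) => (W i)⁻¹ := measurable_pi_lambda _ fun i => (measurable_pi_apply i).inv
  haveI : IsProbabilityMeasure (ν.map fun (V : GaugeField P k G) (i : ι) => (V (b i))⁻¹) := Measure.isProbabilityMeasure_map hΨ.aemeasurable
  haveI : (ν.map fun (V : GaugeField P k G) (i : ι) => (V (b i))⁻¹).IsMulLeftInvariant := by
    refine ⟨fun g => ?_⟩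
    obtain ⟨v, hv⟩ := exists_gaugeTransf_mul_right htgt hpriv g
    have hcomp : ((fun W : ι → G => g * W) ∘ fun (V : GaugeField P k G) (i : ι) => (V (b i))⁻¹) =
        (fun (V : GaugeField P k G) (i : ι) => (V (b i))⁻¹) ∘ GaugeField.gaugeAct v := by
      funext V; funext i
      simp only [Function.comp, Pi.mul_apply, hv V i, mul_inv_rev, inv_inv]
    rw [Measure.map_map (measurable_const_mul g) hΨ, hcomp, ← Measure.map_map hΨ (measurable_gaugeAct v), hν v]
  haveI : (HaarData.haar : Measure G).IsMulLeftInvariant := ⟨fun g => HaarData.map_mul_left g⟩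
  have hleft : ν.map (fun (V : GaugeField P k G) (i : ι) => (V (b i))⁻¹) = Measure.pi fun _ : ι => (HaarData.haar : Measure G) :=
    eq_of_isMulLeftInvariant _ _
  -- invert back
  have hcomp' : (fun (V : GaugeField P k G) (i : ι) => V (b i)) =
      (fun (W : ι → G) (i : ι) => (W i)⁻¹) ∘ fun (V : GaugeField P k G) (i : ι) => (V (b i))⁻¹ := by
    funext V; funext i; simp
  rw [hcomp', ← Measure.map_map hinv hΨ, hleft, map_inv_pi_haar]

/-! ## §2 At the product Haar measure `dU` itself -/

omit [TopologicalSpace G] [IsTopologicalGroup G] [CompactSpace G] [SecondCountableTopology G] [BorelSpace G] in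
/-- `dU` is gauge invariant (push-forward form of `measurePreserving_gaugeAct`). [cite: Balaban1985Averaging, (12) p.19] -/
theorem map_gaugeAct_fieldMeasure (v : GaugeTransf P k G) : (fieldMeasure P k G).map (GaugeField.gaugeAct v) = fieldMeasure P k G :=
  (measurePreserving_gaugeAct v).map_eq

/-- Private-source marginals of `dU` are product Haar (an instance of §1; true for every injective family, stated in §1's generality only). [cite: Balaban1985Averaging, (10) p.19 (bookkeeping)] -/
theorem map_evalFamily_fieldMeasure_eq_pi_haar (hsrc : Function.Injective fun i => (b i).src) (hpriv : ∀ i i', (b i).src ≠ (b i').tgt) :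
    (fieldMeasure P k G).map (fun (V : GaugeField P k G) (i : ι) => V (b i)) = Measure.pi fun _ : ι => (HaarData.haar : Measure G) :=
  map_evalFamily_eq_pi_haar hsrc hpriv _ map_gaugeAct_fieldMeasure

/-- `∫ φ(V ∘ b) dV = ∫ φ dHaar^ι` for a private-source family. [cite: Balaban1985Averaging, (10) p.19 (bookkeeping)] -/
theorem integral_comp_evalFamily_fieldMeasure (hsrc : Function.Injective fun i => (b i).src) (hpriv : ∀ i i', (b i).src ≠ (b i').tgt)
    (φ : (ι → G) → ℝ) (hφ : AEStronglyMeasurable φ (Measure.pi fun _ : ι => (HaarData.haar : Measure G))) :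
    ∫ V, φ (fun i => V (b i)) ∂(fieldMeasure P k G) = ∫ W, φ W ∂(Measure.pi fun _ : ι => (HaarData.haar : Measure G)) :=
  integral_comp_evalFamily hsrc hpriv _ map_gaugeAct_fieldMeasure φ hφ

end Generic

/-! ## §3 At the image law of ANY covariant averaging of the standing range -/

section ImageLaw

variable {P : Params} {j : ℕ} {G : Type*} [GaugeGroup G] [MeasurableSpace G]
  [TopologicalSpace G] [IsTopologicalGroup G] [CompactSpace G] [SecondCountableTopology G] [BorelSpace G] [HaarData G] [MeasurableMul₂ G]
  {ι : Type*} [Fintype ι] {b : ι → PBond P (j + 1)}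

/-- **`Law_{dU}((Ū(·)(b i))_i) = Haar^ι` FOR EVERY COVARIANT AVERAGING AND EVERY PRIVATE-SOURCE FAMILY OF COARSE BONDS** (standing range, measurable `Ū`):
the E6′ defect, if any, is invisible on private-source families. [cite: Balaban1987RG1, (2.1) p.265] -/
theorem map_evalFamily_imageLaw_eq_pi_haar (hj : j + 1 ≤ P.m + P.K) (av : Averaging P j G) (havg : Measurable av.avg)
    (hsrc : Function.Injective fun i => (b i).src) (hpriv : ∀ i i', (b i).src ≠ (b i').tgt) :
    (fieldMeasure P j G).map (fun (U : GaugeField P j G) (i : ι) => av.avg U (b i)) = Measure.pi fun _ : ι => (HaarData.haar : Measure G) := by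
  haveI := isProbabilityMeasure_imageLaw av havg
  have h := map_evalFamily_eq_pi_haar hsrc hpriv ((fieldMeasure P j G).map av.avg) (map_gaugeAct_imageLaw hj av havg)
  rwa [Measure.map_map (measurable_evalFamily b) havg] at h

/-- `∫ φ((Ū U) ∘ b) dU = ∫ φ dHaar^ι` for every covariant averaging and private-source family. [cite: Balaban1987RG1, (2.1) p.265 (bookkeeping)] -/
theorem integral_comp_avg_evalFamily (hj : j + 1 ≤ P.m + P.K) (av : Averaging P j G) (havg : Measurable av.avg)
    (hsrc : Function.Injective fun i => (b i).src) (hpriv : ∀ i i', (b i).src ≠ (b i').tgt)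
    (φ : (ι → G) → ℝ) (hφ : AEStronglyMeasurable φ (Measure.pi fun _ : ι => (HaarData.haar : Measure G))) :
    ∫ U, φ (fun i => av.avg U (b i)) ∂(fieldMeasure P j G) = ∫ W, φ W ∂(Measure.pi fun _ : ι => (HaarData.haar : Measure G)) := by
  have hmeas : Measurable fun (U : GaugeField P j G) (i : ι) => av.avg U (b i) := (measurable_evalFamily b).comp havg
  rw [← map_evalFamily_imageLaw_eq_pi_haar hj av havg hsrc hpriv] at hφ ⊢
  exact (integral_map hmeas.aemeasurable hφ).symm

/-- … `= ∫ φ(V ∘ b) dV`: on private-source families the image law of every covariant averaging AGREES WITH `dV`. [cite: Balaban1987RG1, (2.1) p.265 (bookkeeping; E6′ itself NOT IN PRINT)] -/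
theorem integral_comp_avg_evalFamily_eq (hj : j + 1 ≤ P.m + P.K) (av : Averaging P j G) (havg : Measurable av.avg)
    (hsrc : Function.Injective fun i => (b i).src) (hpriv : ∀ i i', (b i).src ≠ (b i').tgt)
    (φ : (ι → G) → ℝ) (hφ : AEStronglyMeasurable φ (Measure.pi fun _ : ι => (HaarData.haar : Measure G))) :
    ∫ U, φ (fun i => av.avg U (b i)) ∂(fieldMeasure P j G) = ∫ V, φ (fun i => V (b i)) ∂(fieldMeasure P (j + 1) G) := by
  rw [integral_comp_avg_evalFamily hj av havg hsrc hpriv φ hφ, integral_comp_evalFamily_fieldMeasure hsrc hpriv φ hφ]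

/-- The private-TARGET twin: `Law_{dU}((Ū(·)(b i))_i) = Haar^ι` for every covariant averaging (e.g. the `d` coarse bonds issuing from one coarse site).
[cite: Balaban1987RG1, (2.1) p.265] -/
theorem map_evalFamily_imageLaw_eq_pi_haar_of_tgt (hj : j + 1 ≤ P.m + P.K) (av : Averaging P j G) (havg : Measurable av.avg)
    (htgt : Function.Injective fun i => (b i).tgt) (hpriv : ∀ i i', (b i).tgt ≠ (b i').src) :
    (fieldMeasure P j G).map (fun (U : GaugeField P j G) (i : ι) => av.avg U (b i)) = Measure.pi fun _ : ι => (HaarData.haar : Measure G) := by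
  haveI := isProbabilityMeasure_imageLaw av havg
  have h := map_evalFamily_eq_pi_haar_of_tgt htgt hpriv ((fieldMeasure P j G).map av.avg) (map_gaugeAct_imageLaw hj av havg)
  rwa [Measure.map_map (measurable_evalFamily b) havg] at h

end ImageLaw



/-! # AT THE [B10] SLOT OF RECORD -/

section Slot

open Literature.MathematicalPhysics.QuantumFieldTheory.Balaban1985CMP102.Setting (Scales)
open Literature.MathematicalPhysics.QuantumFieldTheory.Balaban1983to89.B10RunsOfRecord (avOfPrint TOfPrint)
open Literature.MathematicalPhysics.QuantumFieldTheory.Balaban1983to89.B10Eq2HaarCompatibility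
open Literature.MathematicalPhysics.QuantumFieldTheory.Balaban1983to89.Node00 (SU TFamily₃ tOfRecord₃)
open Summit.QuantumFields.YangMills.BalabanUVNodes.N08HaarCompatibilityOneBond (map_gaugeAct_imageLaw_avOfPrint)

variable (N : ℕ) [NeZero N] {L : ℕ} {ι : Type*} [Fintype ι]

omit [NeZero N] in
/-- `SU(N)` is second countable (plumbing). [folklore] -/
private theorem secondCountableTopology_SU : SecondCountableTopology (SU N) := by
  haveI := secondCountableTopology_matrix (n := Fin N)
  exact Topology.IsEmbedding.subtypeVal.secondCountableTopology

/-! ## §4. At the [B10] slot: private-source ∕ private-target families of coarse bond variables of print's averaging of record are exactly product Haar -/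

/-- **`Law_{dU}((Ū(U)(b i))_i) = Haar^ι` at `Ū := avOfPrint N S j`, EVERY level, every private-SOURCE family `b`.** [cite: Balaban1987RG1, (2.1) p.265, (0.4) p.253 (bookkeeping)] -/
theorem map_evalFamily_avOfPrint_eq_pi_haar (S : Scales L) (j : ℕ) {b : ι → PBond S.P (j + 1)}
    (hsrc : Function.Injective fun i => (b i).src) (hpriv : ∀ i i', (b i).src ≠ (b i').tgt) :
    (fieldMeasure S.P j (SU N)).map (fun (U : GaugeField S.P j (SU N)) (i : ι) => (avOfPrint N S j).avg U (b i)) =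
      Measure.pi fun _ : ι => (HaarData.haar : Measure (SU N)) := by
  haveI := secondCountableTopology_SU N
  haveI := isProbabilityMeasure_imageLaw (avOfPrint N S j) (measurable_avOfPrint N S j)
  have h := map_evalFamily_eq_pi_haar hsrc hpriv ((fieldMeasure S.P j (SU N)).map (avOfPrint N S j).avg)
    (map_gaugeAct_imageLaw_avOfPrint N S j)
  rwa [Measure.map_map (measurable_evalFamily b) (measurable_avOfPrint N S j)] at h

/-- The private-TARGET twin (e.g. the `d` coarse bonds issuing from one coarse site). [cite: Balaban1987RG1, (2.1) p.265, (0.4) p.253 (bookkeeping)] -/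
theorem map_evalFamily_avOfPrint_eq_pi_haar_of_tgt (S : Scales L) (j : ℕ) {b : ι → PBond S.P (j + 1)}
    (htgt : Function.Injective fun i => (b i).tgt) (hpriv : ∀ i i', (b i).tgt ≠ (b i').src) :
    (fieldMeasure S.P j (SU N)).map (fun (U : GaugeField S.P j (SU N)) (i : ι) => (avOfPrint N S j).avg U (b i)) =
      Measure.pi fun _ : ι => (HaarData.haar : Measure (SU N)) := by
  haveI := secondCountableTopology_SU N
  haveI := isProbabilityMeasure_imageLaw (avOfPrint N S j) (measurable_avOfPrint N S j)
  have h := map_evalFamily_eq_pi_haar_of_tgt htgt hpriv ((fieldMeasure S.P j (SU N)).map (avOfPrint N S j).avg)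
    (map_gaugeAct_imageLaw_avOfPrint N S j)
  rwa [Measure.map_map (measurable_evalFamily b) (measurable_avOfPrint N S j)] at h

/-- `∫ φ((Ū U) ∘ b) dU = ∫ φ dHaar^ι` (private sources, every level). [cite: Balaban1987RG1, (2.1) p.265 (bookkeeping)] -/
theorem integral_comp_avOfPrint_evalFamily (S : Scales L) (j : ℕ) {b : ι → PBond S.P (j + 1)}
    (hsrc : Function.Injective fun i => (b i).src) (hpriv : ∀ i i', (b i).src ≠ (b i').tgt)
    (φ : (ι → SU N) → ℝ) (hφ : Measurable φ) :
    ∫ U, φ (fun i => (avOfPrint N S j).avg U (b i)) ∂(fieldMeasure S.P j (SU N)) =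
      ∫ W, φ W ∂(Measure.pi fun _ : ι => (HaarData.haar : Measure (SU N))) := by
  have hmeas : Measurable fun (U : GaugeField S.P j (SU N)) (i : ι) => (avOfPrint N S j).avg U (b i) :=
    (measurable_evalFamily b).comp (measurable_avOfPrint N S j)
  rw [← map_evalFamily_avOfPrint_eq_pi_haar N S j hsrc hpriv]
  exact (integral_map hmeas.aemeasurable hφ.aestronglyMeasurable).symm

/-- `∫ φ((Ū U) ∘ b) dU = ∫ φ dHaar^ι` (private targets, every level). [cite: Balaban1987RG1, (2.1) p.265 (bookkeeping)] -/
theorem integral_comp_avOfPrint_evalFamily_of_tgt (S : Scales L) (j : ℕ) {b : ι → PBond S.P (j + 1)}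
    (htgt : Function.Injective fun i => (b i).tgt) (hpriv : ∀ i i', (b i).tgt ≠ (b i').src)
    (φ : (ι → SU N) → ℝ) (hφ : Measurable φ) :
    ∫ U, φ (fun i => (avOfPrint N S j).avg U (b i)) ∂(fieldMeasure S.P j (SU N)) =
      ∫ W, φ W ∂(Measure.pi fun _ : ι => (HaarData.haar : Measure (SU N))) := by
  have hmeas : Measurable fun (U : GaugeField S.P j (SU N)) (i : ι) => (avOfPrint N S j).avg U (b i) :=
    (measurable_evalFamily b).comp (measurable_avOfPrint N S j)
  rw [← map_evalFamily_avOfPrint_eq_pi_haar_of_tgt N S j htgt hpriv]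
  exact (integral_map hmeas.aemeasurable hφ.aestronglyMeasurable).symm

/-! ## §5. The letter: for every version of (10), `T1` integrates every private-source ∕ private-target observable to its Haar ∕ `dV` value -/

variable (L) in
omit [Fintype ι] in
/-- The push-forward identity (10) at the test function `φ ∘ (V ↦ V ∘ b)` (plumbing for both cases). [cite: Balaban1985Averaging, (10) p.19 (bookkeeping)] -/
theorem integral_T_one_mul_comp_evalFamily_eq_integral_avg (𝔗 : TFamily₃ N L) (S : Scales L) (j : ℕ) (b : ι → PBond S.P (j + 1))
    (φ : (ι → SU N) → ℝ) (hφm : Measurable φ) (hφb : ∃ C : ℝ, ∀ W, |φ W| ≤ C) :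
    ∫ V, (𝔗 S j).T 1 V * φ (fun i => V (b i)) ∂(fieldMeasure S.P (j + 1) (SU N)) =
      ∫ U, φ (fun i => (avOfPrint N S j).avg U (b i)) ∂(fieldMeasure S.P j (SU N)) := by
  obtain ⟨C, hC⟩ := hφb
  have h := (𝔗 S j).isRT 1 (integrable_const _) (fun V => φ (fun i => V (b i))) (hφm.comp (measurable_evalFamily b))
    ⟨C, fun V => hC _⟩
  rw [h]
  congr 1
  funext U
  simp

variable (L) in
/-- **THE E6′ LETTER ON PRIVATE-SOURCE FAMILIES, FOR EVERY VERSION**: `∫ (𝔗 S j).T 1 (V) · φ(V ∘ b) dV = ∫ φ dHaar^ι`. [cite: Balaban1985Averaging, (10) p.19; Balaban1987RG1, (2.1) p.265 (bookkeeping)] -/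
theorem integral_T_one_mul_comp_evalFamily (𝔗 : TFamily₃ N L) (S : Scales L) (j : ℕ) {b : ι → PBond S.P (j + 1)}
    (hsrc : Function.Injective fun i => (b i).src) (hpriv : ∀ i i', (b i).src ≠ (b i').tgt)
    (φ : (ι → SU N) → ℝ) (hφm : Measurable φ) (hφb : ∃ C : ℝ, ∀ W, |φ W| ≤ C) :
    ∫ V, (𝔗 S j).T 1 V * φ (fun i => V (b i)) ∂(fieldMeasure S.P (j + 1) (SU N)) =
      ∫ W, φ W ∂(Measure.pi fun _ : ι => (HaarData.haar : Measure (SU N))) := by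
  rw [integral_T_one_mul_comp_evalFamily_eq_integral_avg N L 𝔗 S j b φ hφm hφb,
    integral_comp_avOfPrint_evalFamily N S j hsrc hpriv φ hφm]

variable (L) in
/-- The private-TARGET twin of `integral_T_one_mul_comp_evalFamily`. [cite: Balaban1985Averaging, (10) p.19; Balaban1987RG1, (2.1) p.265 (bookkeeping)] -/
theorem integral_T_one_mul_comp_evalFamily_of_tgt (𝔗 : TFamily₃ N L) (S : Scales L) (j : ℕ) {b : ι → PBond S.P (j + 1)}
    (htgt : Function.Injective fun i => (b i).tgt) (hpriv : ∀ i i', (b i).tgt ≠ (b i').src)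
    (φ : (ι → SU N) → ℝ) (hφm : Measurable φ) (hφb : ∃ C : ℝ, ∀ W, |φ W| ≤ C) :
    ∫ V, (𝔗 S j).T 1 V * φ (fun i => V (b i)) ∂(fieldMeasure S.P (j + 1) (SU N)) =
      ∫ W, φ W ∂(Measure.pi fun _ : ι => (HaarData.haar : Measure (SU N))) := by
  rw [integral_T_one_mul_comp_evalFamily_eq_integral_avg N L 𝔗 S j b φ hφm hφb,
    integral_comp_avOfPrint_evalFamily_of_tgt N S j htgt hpriv φ hφm]

variable (L) in
/-- **`(T1)·dV = dV` ON THE σ-ALGEBRA OF EVERY PRIVATE-SOURCE FAMILY**: `∫ T1 · φ(V ∘ b) dV = ∫ φ(V ∘ b) dV`, every version, member, level.  (E6′ proper = the same on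
the full σ-algebra — undecided at `N ≥ 2`.) [cite: Balaban1985Averaging, (10) p.19; Balaban1987RG1, (2.1) p.265 (bookkeeping; E6′ NOT IN PRINT)] -/
theorem integral_T_one_mul_comp_evalFamily_eq (𝔗 : TFamily₃ N L) (S : Scales L) (j : ℕ) {b : ι → PBond S.P (j + 1)}
    (hsrc : Function.Injective fun i => (b i).src) (hpriv : ∀ i i', (b i).src ≠ (b i').tgt)
    (φ : (ι → SU N) → ℝ) (hφm : Measurable φ) (hφb : ∃ C : ℝ, ∀ W, |φ W| ≤ C) :
    ∫ V, (𝔗 S j).T 1 V * φ (fun i => V (b i)) ∂(fieldMeasure S.P (j + 1) (SU N)) =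
      ∫ V, φ (fun i => V (b i)) ∂(fieldMeasure S.P (j + 1) (SU N)) := by
  haveI := secondCountableTopology_SU N
  rw [integral_T_one_mul_comp_evalFamily N L 𝔗 S j hsrc hpriv φ hφm hφb,
    integral_comp_evalFamily_fieldMeasure hsrc hpriv φ hφm.aestronglyMeasurable]

variable (L) in
/-- The private-TARGET twin of `integral_T_one_mul_comp_evalFamily_eq`. [cite: Balaban1985Averaging, (10) p.19; Balaban1987RG1, (2.1) p.265 (bookkeeping; E6′ NOT IN PRINT)] -/
theorem integral_T_one_mul_comp_evalFamily_eq_of_tgt (𝔗 : TFamily₃ N L) (S : Scales L) (j : ℕ) {b : ι → PBond S.P (j + 1)}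
    (htgt : Function.Injective fun i => (b i).tgt) (hpriv : ∀ i i', (b i).tgt ≠ (b i').src)
    (φ : (ι → SU N) → ℝ) (hφm : Measurable φ) (hφb : ∃ C : ℝ, ∀ W, |φ W| ≤ C) :
    ∫ V, (𝔗 S j).T 1 V * φ (fun i => V (b i)) ∂(fieldMeasure S.P (j + 1) (SU N)) =
      ∫ V, φ (fun i => V (b i)) ∂(fieldMeasure S.P (j + 1) (SU N)) := by
  haveI := secondCountableTopology_SU N
  haveI : IsProbabilityMeasure (fieldMeasure S.P (j + 1) (SU N)) := inferInstance
  rw [integral_T_one_mul_comp_evalFamily_of_tgt N L 𝔗 S j htgt hpriv φ hφm hφb,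
    ← map_evalFamily_eq_pi_haar_of_tgt htgt hpriv (fieldMeasure S.P (j + 1) (SU N)) map_gaugeAct_fieldMeasure]
  exact integral_map (measurable_evalFamily b).aemeasurable hφm.aestronglyMeasurable

variable (L) in
/-- **THE DEFECT `T1 − 1` IS ORTHOGONAL TO EVERY PRIVATE-SOURCE OBSERVABLE**: `∫ ((𝔗 S j).T 1 − 1) · φ(V ∘ b) dV = 0`. [cite: Balaban1985Averaging, (10) p.19; Balaban1987RG1, (2.1) p.265 (bookkeeping; E6′ NOT IN PRINT)] -/
theorem integral_T_one_sub_one_mul_comp_evalFamily (𝔗 : TFamily₃ N L) (S : Scales L) (j : ℕ) {b : ι → PBond S.P (j + 1)}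
    (hsrc : Function.Injective fun i => (b i).src) (hpriv : ∀ i i', (b i).src ≠ (b i').tgt)
    (φ : (ι → SU N) → ℝ) (hφm : Measurable φ) (hφb : ∃ C : ℝ, ∀ W, |φ W| ≤ C) :
    ∫ V, ((𝔗 S j).T 1 V - 1) * φ (fun i => V (b i)) ∂(fieldMeasure S.P (j + 1) (SU N)) = 0 := by
  obtain ⟨C, hC⟩ := hφb
  have hφV : AEStronglyMeasurable (fun V : GaugeField S.P (j + 1) (SU N) => φ (fun i => V (b i))) (fieldMeasure S.P (j + 1) (SU N)) :=
    (hφm.comp (measurable_evalFamily b)).aestronglyMeasurable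
  have hbd : ∀ᵐ V ∂(fieldMeasure S.P (j + 1) (SU N)), ‖φ (fun i => V (b i))‖ ≤ C :=
    ae_of_all _ fun V => by rw [Real.norm_eq_abs]; exact hC _
  have h1 : Integrable (fun V => (𝔗 S j).T 1 V * φ (fun i => V (b i))) (fieldMeasure S.P (j + 1) (SU N)) :=
    (integrable_T_one (𝔗 S j)).mul_bdd hφV hbd
  have h2 : Integrable (fun V : GaugeField S.P (j + 1) (SU N) => (1 : ℝ) * φ (fun i => V (b i))) (fieldMeasure S.P (j + 1) (SU N)) :=
    (integrable_const (1 : ℝ)).mul_bdd hφV hbd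
  have hsplit : (fun V => ((𝔗 S j).T 1 V - 1) * φ (fun i => V (b i))) =
      fun V => (𝔗 S j).T 1 V * φ (fun i => V (b i)) - (1 : ℝ) * φ (fun i => V (b i)) := by
    funext V; ring
  rw [hsplit, integral_sub h1 h2, integral_T_one_mul_comp_evalFamily_eq N L 𝔗 S j hsrc hpriv φ hφm ⟨C, hC⟩]
  simp

end Slot

end Summit.QuantumFields.YangMills.BalabanUVNodes.N08HaarCompatibilityPrivateSources

end
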